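import Mathlib

/-!
# Arithmetic endings of PROPOSITION S (smoothness of the model family `X_{d;c′,k′}`)

certified instances and evidence bearing on the general Hodge conjecture; no claim.

Def-free helper (pub-hlocus census, record `og81/CODIM-ONE-SIGMA-g32.md` §1e, PROPOSITION S, lead gen 32;
referee-read R138).  The paper proof of the smoothness of the model hypersurfaces
`F = Σ uᵢvᵢ(uᵢ^{d-2} + vᵢ^{d-2} + q) + Σ zⱼ(yⱼ^{d-1} + zⱼ^{d-1})` reduces a hypothetical singular point to the
arithmetic identity `|T|^{2(d-1)} |S|^{(d-1)(d-2)} = C_d := d^d (d-1)^{(d-1)(d-2)} / (d-2)^{(d-1)(d-2)}` with the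
left side an algebraic integer, and ends with three arithmetic facts, kernel-checked here for ALL `d`:

* `C_d ∉ ℤ` for every `d ≥ 5`, i.e. `(d-2)^{(d-1)(d-2)} ∤ d^d (d-1)^{(d-1)(d-2)}` (`cd_not_dvd`);
* `2916 = C_4` is not a cube (`not_cube_2916`);
* `108 = C_3` is not a square (`not_sq_108`).
-/

namespace Summit.HodgeConjecture.HodgeConjecture.HodgeLocus.Census.ModelFamilySmooth

/-- An odd prime factor of `m` obstructs `m^N ∣ (m+2)^M (m+1)^N` (for `N ≠ 0`). -/
theorem not_dvd_of_odd_prime_factor {p m N M : ℕ} (hp : p.Prime) (hp2 : p ≠ 2) (hpm : p ∣ m)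
    (hN : N ≠ 0) : ¬ m ^ N ∣ (m + 2) ^ M * (m + 1) ^ N := by
  intro h
  have h1 : p ∣ (m + 2) ^ M * (m + 1) ^ N := dvd_trans (dvd_trans hpm (dvd_pow_self m hN)) h
  rcases (Nat.Prime.dvd_mul hp).1 h1 with h2 | h2
  · have h3 : p ∣ m + 2 := hp.dvd_of_dvd_pow h2
    have h4 : p ∣ 2 := (Nat.dvd_add_right hpm).mp h3
    have h6 : p ≤ 2 := Nat.le_of_dvd (by norm_num) h4
    have h7 : 2 ≤ p := hp.two_le
    omega
  · have h3 : p ∣ m + 1 := hp.dvd_of_dvd_pow h2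
    have h4 : p ∣ 1 := (Nat.dvd_add_right hpm).mp h3
    exact hp.one_lt.ne' (Nat.dvd_one.1 h4)

/-- The case `4 ∣ m`: the 2-adic count obstructs `m^{(m+1)m} ∣ (m+2)^{m+2} (m+1)^{(m+1)m}`. -/
theorem not_dvd_of_four_dvd {m : ℕ} (hm : 3 ≤ m) (h4 : 4 ∣ m) :
    ¬ m ^ ((m + 1) * m) ∣ (m + 2) ^ (m + 2) * (m + 1) ^ ((m + 1) * m) := by
  intro h
  obtain ⟨e, rfl⟩ := h4
  set N := (4 * e + 1) * (4 * e) with hNdef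
  have h2m : 2 ∣ 4 * e := ⟨2 * e, by ring⟩
  have hA : 2 ^ N ∣ (4 * e + 2) ^ (4 * e + 2) * (4 * e + 1) ^ N :=
    dvd_trans (pow_dvd_pow_of_dvd h2m N) h
  have hcop1 : Nat.Coprime 2 (4 * e + 1) := Nat.prime_two.coprime_iff_not_dvd.2 (by omega)
  have hB : 2 ^ N ∣ (4 * e + 2) ^ (4 * e + 2) :=
    (Nat.Coprime.pow N N hcop1).dvd_of_dvd_mul_right hA
  have hsplit : (4 * e + 2) ^ (4 * e + 2) = 2 ^ (4 * e + 2) * (2 * e + 1) ^ (4 * e + 2) := by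
    rw [← mul_pow]; congr 1; ring
  rw [hsplit] at hB
  have hcop2 : Nat.Coprime 2 (2 * e + 1) := Nat.prime_two.coprime_iff_not_dvd.2 (by omega)
  have hC : 2 ^ N ∣ 2 ^ (4 * e + 2) :=
    (Nat.Coprime.pow N (4 * e + 2) hcop2).dvd_of_dvd_mul_right hB
  have hle : 2 ^ N ≤ 2 ^ (4 * e + 2) := Nat.le_of_dvd (by positivity) hC
  have hlt : 4 * e + 2 < N := by
    have he : 1 ≤ e := by omega
    rw [hNdef]; nlinarith
  have : 2 ^ (4 * e + 2) < 2 ^ N := Nat.pow_lt_pow_right (by norm_num) hlt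
  omega

/-- Main arithmetic lemma in the shifted variable `m = d - 2 ≥ 3`. -/
theorem not_dvd_shift {m : ℕ} (hm : 3 ≤ m) :
    ¬ m ^ ((m + 1) * m) ∣ (m + 2) ^ (m + 2) * (m + 1) ^ ((m + 1) * m) := by
  have hN : (m + 1) * m ≠ 0 := by positivity
  rcases Nat.even_or_odd m with hev | hodd
  · -- m even: either 4 ∣ m, or m/2 is odd ≥ 3 and supplies an odd prime factor of m
    by_cases h4 : 4 ∣ m
    · exact not_dvd_of_four_dvd hm h4
    · obtain ⟨k, hk⟩ := hev
      have hk1 : k ≠ 1 := by omega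
      obtain ⟨p, hp, hpk⟩ := Nat.exists_prime_and_dvd hk1
      have hkodd : ¬ 2 ∣ k := by omega
      have hp2 : p ≠ 2 := by rintro rfl; exact hkodd hpk
      have hpm : p ∣ m := by rw [hk]; exact dvd_trans hpk ⟨2, by ring⟩
      exact not_dvd_of_odd_prime_factor hp hp2 hpm hN
  · have hm1 : m ≠ 1 := by omega
    obtain ⟨p, hp, hpm⟩ := Nat.exists_prime_and_dvd hm1
    have hp2 : p ≠ 2 := by
      rintro rfl
      obtain ⟨k, hk⟩ := hodd
      omega
    exact not_dvd_of_odd_prime_factor hp hp2 hpm hN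

/-- `C_d ∉ ℤ` for `d ≥ 5`: `(d-2)^{(d-1)(d-2)}` does not divide `d^d (d-1)^{(d-1)(d-2)}`. -/
theorem cd_not_dvd (d : ℕ) (hd : 5 ≤ d) :
    ¬ (d - 2) ^ ((d - 1) * (d - 2)) ∣ d ^ d * (d - 1) ^ ((d - 1) * (d - 2)) := by
  obtain ⟨m, rfl⟩ : ∃ m, d = m + 2 := ⟨d - 2, by omega⟩
  have h1 : m + 2 - 2 = m := by omega
  have h2 : m + 2 - 1 = m + 1 := by omega
  rw [h1, h2]
  exact not_dvd_shift (by omega)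

/-- The `d = 4` ending: `C_4 = 4⁴·3⁶/2⁶ = 2916` and `2916` is not a perfect cube. -/
theorem c4_eq : 4 ^ 4 * 3 ^ 6 / 2 ^ 6 = 2916 ∧ 2 ^ 6 ∣ 4 ^ 4 * 3 ^ 6 := by decide

/-- `2916` is not a perfect cube (in `ℕ`). -/
theorem not_cube_2916 : ∀ n : ℕ, n ^ 3 ≠ 2916 := by
  intro n
  rcases Nat.lt_or_ge n 15 with h | h
  · interval_cases n <;> decide
  · have h1 : 15 ^ 3 ≤ n ^ 3 := Nat.pow_le_pow_left h 3
    omega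

/-- The `d = 3` ending: `C_3 = 3³·2² = 108` and `108` is not a perfect square. -/
theorem c3_eq : 3 ^ 3 * 2 ^ 2 = 108 := by decide

/-- `108` is not a perfect square (in `ℕ`). -/
theorem not_sq_108 : ∀ n : ℕ, n ^ 2 ≠ 108 := by
  intro n
  rcases Nat.lt_or_ge n 11 with h | h
  · interval_cases n <;> decide
  · have h1 : 11 ^ 2 ≤ n ^ 2 := Nat.pow_le_pow_left h 2
    omega

/-- Integer form of the `d = 4` ending: `x³ = 2916` has no solution in `ℤ`. -/
theorem not_cube_2916_int : ∀ x : ℤ, x ^ 3 ≠ 2916 := by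
  intro x hx
  have h := congrArg Int.natAbs hx
  rw [Int.natAbs_pow] at h
  exact not_cube_2916 x.natAbs (by simpa using h)

/-- Integer form of the `d = 3` ending: `x² = 108` has no solution in `ℤ`. -/
theorem not_sq_108_int : ∀ x : ℤ, x ^ 2 ≠ 108 := by
  intro x hx
  have h := congrArg Int.natAbs hx
  rw [Int.natAbs_pow] at h
  exact not_sq_108 x.natAbs (by simpa using h)

end Summit.HodgeConjecture.HodgeConjecture.HodgeLocus.Census.ModelFamilySmooth
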